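import Summits.QuantumFields.YangMills.Theorems.F4SubCurvatureDoorShortRootRigiditySliceDensity
import Mathlib
import HarnessLib

/-!
# Piece H4 «CIRCLE TO SPHERE» of SUB-LINE g22-A «HERMITIAN SLICE» — unfolded, elementary
# (planner ym-idea-3 g22; crux ⟨stmt-QuantumFields-23035⟩ `F4SubCurvatureDoor.ShortRootRigidity`, registered stub `:146 stub_oddModeRigidity`;
# skeleton `Cruxes/ShortRootRigidity/Lines/hermitian_slice.lean` 7d6b9371ad68 :124 `CircleToSphere`)

Free-hands work of the EXTRA WIDTH seat ym-line-sfw-p2-w4 (gen 25).  The statement: a kernel `K : ℝ⁴ → ℝ` continuous off `0`, invariant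
under the signed permutations `W(B₄)` and under the isometries of the hexagonal plane `Π₀ = span(e₀, (0,1,1,1)/√3)` acting as `R ⊕ id` on
`Π₀ ⊕ Π₀^⊥` (`K (ι (R y) + ι^⊥ x) = K (ι y + ι^⊥ x)` for `y ≠ 0`, with the registered frames `ι = planeEmb`, `ι^⊥ = perpEmb`), is
`O(4)`-invariant.  PROOF (the card's iteration, no Lie theory): every `x ≠ 0` can be moved, without changing `K`, `‖x‖`, and keeping
`x₀ ≥ 0`, to a point whose TAIL `x₁² + x₂² + x₃²` is at most `2/3` of the old one — flip the signs of `x₁, x₂, x₃` to `≥ 0` (coordinate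
mirrors, ✓`isSignedPerm_reflection_single`), write `x = ι y + ι^⊥ u` and move `y` onto the `e₀`-axis of `Π₀` by a planar reflection
(`Submodule.reflection_sub`); since `x⃗ ≥ 0` forces `(x₁+x₂+x₃)² ≥ x₁²+x₂²+x₃²`, the new tail `‖u‖² = tail − (x₁+x₂+x₃)²/3` is `≤ (2/3)·tail`.
Iterating `n` times gives points `zₙ` with `K zₙ = K x` and `‖zₙ − ‖x‖e₀‖² ≤ 2·(2/3)ⁿ·tail(x)`, so `K x = K (‖x‖ e₀)` by continuity of `K`
at `‖x‖e₀ ≠ 0`; hence `K (R x) = K (‖Rx‖ e₀) = K (‖x‖ e₀) = K x` for every linear isometry `R`.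

`circleToSphere_unfolded` is H4 with its binders written out character-for-character (the Cruxes file is not importable).
HONEST LABEL: one elementary piece (S–M) of an INSURANCE sub-line (g22-A, PASS tier B) for `:146`; H1, H2 (= R1–R4; R2/R4 open), H3,
`:146`, ⟨23035⟩, ⟨23125⟩ and R2d are OPEN; no crux, ladder rung, leaf or summit is proved; the Yang–Mills mass gap is NOT proved by this.
-/

noncomputable section

namespace Summit.QuantumFields.YangMills.Theorems.F4SubCurvatureDoorHermitianCircleToSphere

open scoped Topology BigOperators RealInnerProductSpace
open Filter Set
open Summit.QuantumFields.YangMills.Cruxes.OSLegsAtWeakCouplingC.Sketch (IsSignedPerm)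
open Summit.QuantumFields.YangMills.Theorems.F4SubCurvatureDoorMirrorAnalyticityRegistered (E4)
open Summit.QuantumFields.YangMills.Theorems.F4SubCurvatureDoorSliceDensityRegistered
  (E2 planeEmb perpEmb norm_sq_planeEmb_add_perpEmb planeEmb_add_perpEmb_apply_zero)
open Summit.QuantumFields.YangMills.Theorems.F4SubCurvatureDoorGlobalReduction
  (reflection_single_apply isSignedPerm_reflection_single)

variable {K : E4 → ℝ}

/-! ## Coordinates -/

/-- Two vectors of `ℝ⁴` with the same squared coordinates have the same norm. -/
theorem norm_eq_of_sq_coord_eq {x z : E4} (h : ∀ i, z i ^ 2 = x i ^ 2) : ‖z‖ = ‖x‖ := by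
  have n4 : ∀ v : E4, ‖v‖ ^ 2 = v 0 ^ 2 + v 1 ^ 2 + v 2 ^ 2 + v 3 ^ 2 := fun v =>
    by rw [EuclideanSpace.real_norm_sq_eq, Fin.sum_univ_four]
  have hsq : ‖z‖ ^ 2 = ‖x‖ ^ 2 := by rw [n4, n4, h 0, h 1, h 2, h 3]
  exact (sq_eq_sq₀ (norm_nonneg _) (norm_nonneg _)).1 hsq

/-- **The orthogonal decomposition `ℝ⁴ = Π₀ ⊕ Π₀^⊥` in the registered frames**: `x = ι y + ι^⊥ u` with
`y = (x₀, (x₁+x₂+x₃)/√3)` and `u = ((x₁−x₂)/√2, (x₁+x₂−2x₃)/√6)`. -/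
theorem planeEmb_add_perpEmb_decomp (x : E4) :
    planeEmb (WithLp.toLp 2 ![x 0, (x 1 + x 2 + x 3) / Real.sqrt 3])
      + perpEmb (WithLp.toLp 2 ![(x 1 - x 2) / Real.sqrt 2, (x 1 + x 2 - 2 * x 3) / Real.sqrt 6]) = x := by
  have h2 : Real.sqrt 2 ^ 2 = 2 := Real.sq_sqrt (by norm_num)
  have h3 : Real.sqrt 3 ^ 2 = 3 := Real.sq_sqrt (by norm_num)
  have h6 : Real.sqrt 6 ^ 2 = 6 := Real.sq_sqrt (by norm_num)
  have h2' : Real.sqrt 2 ≠ 0 := by positivity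
  have h3' : Real.sqrt 3 ≠ 0 := by positivity
  have h6' : Real.sqrt 6 ≠ 0 := by positivity
  ext i
  fin_cases i
  · simp [planeEmb, perpEmb]
  · simp [planeEmb, perpEmb]
    field_simp
    rw [h2, h3, h6]
    ring
  · simp [planeEmb, perpEmb]
    field_simp
    rw [h2, h3, h6]
    ring
  · simp [planeEmb, perpEmb]
    field_simp
    rw [h3, h6]
    ring

/-! ## Move 1: sign flips (coordinate mirrors are signed permutations) -/

/-- Replacing one coordinate by its absolute value does not change `K` (`W(B₄)`-invariance). -/
theorem exists_flip_coord (hperm : ∀ R : E4 ≃ₗᵢ[ℝ] E4, IsSignedPerm R → ∀ x, K (R x) = K x) (k : Fin 4) (x : E4) :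
    ∃ x' : E4, (∀ i, x' i = if i = k then |x i| else x i) ∧ K x' = K x := by
  by_cases hk : 0 ≤ x k
  · refine ⟨x, fun i => ?_, rfl⟩
    by_cases hik : i = k
    · subst hik; simp [abs_of_nonneg hk]
    · simp [hik]
  · refine ⟨(ℝ ∙ (EuclideanSpace.single k (1 : ℝ) : EuclideanSpace ℝ (Fin 4)))ᗮ.reflection x, fun i => ?_,
      hperm _ (isSignedPerm_reflection_single k) x⟩
    rw [reflection_single_apply]
    by_cases hik : i = k
    · subst hik; simp [abs_of_neg (not_le.1 hk)]
    · simp [hik]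

/-- Flipping the three spatial coordinates to `≥ 0` does not change `K`, the coordinate `0`, or any squared coordinate. -/
theorem exists_flip_tail (hperm : ∀ R : E4 ≃ₗᵢ[ℝ] E4, IsSignedPerm R → ∀ x, K (R x) = K x) (x : E4) :
    ∃ x' : E4, x' 0 = x 0 ∧ x' 1 = |x 1| ∧ x' 2 = |x 2| ∧ x' 3 = |x 3| ∧ K x' = K x := by
  obtain ⟨a, ha, hKa⟩ := exists_flip_coord hperm 1 x
  obtain ⟨b, hb, hKb⟩ := exists_flip_coord hperm 2 a
  obtain ⟨c, hc, hKc⟩ := exists_flip_coord hperm 3 b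
  refine ⟨c, ?_, ?_, ?_, ?_, by rw [hKc, hKb, hKa]⟩
  · rw [hc, if_neg (by decide), hb, if_neg (by decide), ha, if_neg (by decide)]
  · rw [hc, if_neg (by decide), hb, if_neg (by decide), ha, if_pos rfl]
  · rw [hc, if_neg (by decide), hb, if_pos rfl, ha, if_neg (by decide)]
  · rw [hc, if_pos rfl, hb, if_neg (by decide), ha, if_neg (by decide)]

/-! ## Move 2: a planar isometry of `Π₀` puts the `Π₀`-component on the `e₀`-axis -/

/-- **The contraction step.**  For `x ≠ 0` with `x₁, x₂, x₃ ≥ 0` there is `z` with the same norm and the same `K`-value, `z₀ ≥ 0`, and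
tail `‖z‖² − z₀² ≤ (2/3)(‖x‖² − x₀²)`. -/
theorem exists_rotate_step
    (hrot : ∀ (R : E2 ≃ₗᵢ[ℝ] E2) (y x : E2), y ≠ 0 → K (planeEmb (R y) + perpEmb x) = K (planeEmb y + perpEmb x))
    {x : E4} (hx : x ≠ 0) (h1 : 0 ≤ x 1) (h2 : 0 ≤ x 2) (h3 : 0 ≤ x 3) :
    ∃ z : E4, ‖z‖ = ‖x‖ ∧ 0 ≤ z 0 ∧ ‖z‖ ^ 2 - z 0 ^ 2 ≤ 2 / 3 * (‖x‖ ^ 2 - x 0 ^ 2) ∧ K z = K x := by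
  -- the two components
  obtain ⟨y, hy_def⟩ : ∃ y : E2, y = WithLp.toLp 2 ![x 0, (x 1 + x 2 + x 3) / Real.sqrt 3] := ⟨_, rfl⟩
  obtain ⟨u, hu_def⟩ : ∃ u : E2, u = WithLp.toLp 2 ![(x 1 - x 2) / Real.sqrt 2, (x 1 + x 2 - 2 * x 3) / Real.sqrt 6] :=
    ⟨_, rfl⟩
  have hdec : planeEmb y + perpEmb u = x := by rw [hy_def, hu_def]; exact planeEmb_add_perpEmb_decomp x
  have hy0 : y 0 = x 0 := by rw [hy_def]; simp
  have hy1 : y 1 = (x 1 + x 2 + x 3) / Real.sqrt 3 := by rw [hy_def]; simp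
  have h3sq : Real.sqrt 3 ^ 2 = 3 := Real.sq_sqrt (by norm_num)
  have hy1sq : y 1 ^ 2 = (x 1 + x 2 + x 3) ^ 2 / 3 := by rw [hy1, div_pow, h3sq]
  -- `y ≠ 0`
  have hy : y ≠ 0 := by
    intro h0
    have e0 : x 0 = 0 := by rw [← hy0, h0]; rfl
    have e1 : (x 1 + x 2 + x 3) / Real.sqrt 3 = 0 := by rw [← hy1, h0]; rfl
    have hs : x 1 + x 2 + x 3 = 0 := by
      rcases div_eq_zero_iff.1 e1 with h | h
      · exact h
      · exact absurd h (by positivity)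
    apply hx
    ext i
    fin_cases i
    · simpa using e0
    · show x 1 = 0; linarith
    · show x 2 = 0; linarith
    · show x 3 = 0; linarith
  -- the target point of `Π₀` and the planar reflection taking `y` there
  obtain ⟨y', hy'_def⟩ : ∃ y' : E2, y' = WithLp.toLp 2 ![‖y‖, 0] := ⟨_, rfl⟩
  have hy'0 : y' 0 = ‖y‖ := by rw [hy'_def]; simp
  have hy'1 : y' 1 = 0 := by rw [hy'_def]; simp
  have hnorm' : ‖y'‖ = ‖y‖ := by
    have n2 : ∀ v : E2, ‖v‖ ^ 2 = v 0 ^ 2 + v 1 ^ 2 := fun v =>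
      by rw [EuclideanSpace.real_norm_sq_eq, Fin.sum_univ_two]
    have : ‖y'‖ ^ 2 = ‖y‖ ^ 2 := by rw [n2 y', n2 y, hy'0, hy'1, n2 y]; ring
    exact (sq_eq_sq₀ (norm_nonneg _) (norm_nonneg _)).1 this
  have hR : (ℝ ∙ (y - y'))ᗮ.reflection y = y' := Submodule.reflection_sub hnorm'.symm
  -- the new point
  refine ⟨planeEmb y' + perpEmb u, ?_, ?_, ?_, ?_⟩
  · have h := norm_sq_planeEmb_add_perpEmb y' u
    have h' := norm_sq_planeEmb_add_perpEmb y u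
    rw [hdec] at h'
    rw [hnorm'] at h
    exact (sq_eq_sq₀ (norm_nonneg _) (norm_nonneg _)).1 (by rw [h, h'])
  · rw [planeEmb_add_perpEmb_apply_zero, hy'0]; exact norm_nonneg _
  · -- tail of the new point `= ‖u‖² = tail(x) − (x₁+x₂+x₃)²/3 ≤ (2/3)·tail(x)`
    rw [norm_sq_planeEmb_add_perpEmb y' u, planeEmb_add_perpEmb_apply_zero, hy'0, hnorm']
    have h' := norm_sq_planeEmb_add_perpEmb y u
    rw [hdec] at h'
    have hy2 : ‖y‖ ^ 2 = x 0 ^ 2 + (x 1 + x 2 + x 3) ^ 2 / 3 := by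
      rw [EuclideanSpace.real_norm_sq_eq, Fin.sum_univ_two, hy0, hy1sq]
    have hx2 : ‖x‖ ^ 2 = x 0 ^ 2 + x 1 ^ 2 + x 2 ^ 2 + x 3 ^ 2 :=
      by rw [EuclideanSpace.real_norm_sq_eq, Fin.sum_univ_four]
    have hs : x 1 ^ 2 + x 2 ^ 2 + x 3 ^ 2 ≤ (x 1 + x 2 + x 3) ^ 2 := by nlinarith
    nlinarith
  · rw [← hR, hrot _ y u hy, hdec]

/-! ## The iteration -/

/-- **`n` contraction steps**: points `z` with `K z = K x`, `‖z‖ = ‖x‖`, `z₀ ≥ 0` and tail `≤ (2/3)ⁿ·tail(x)`. -/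
theorem exists_iterate (hperm : ∀ R : E4 ≃ₗᵢ[ℝ] E4, IsSignedPerm R → ∀ x, K (R x) = K x)
    (hrot : ∀ (R : E2 ≃ₗᵢ[ℝ] E2) (y x : E2), y ≠ 0 → K (planeEmb (R y) + perpEmb x) = K (planeEmb y + perpEmb x))
    {x : E4} (hx : x ≠ 0) (n : ℕ) :
    ∃ z : E4, ‖z‖ = ‖x‖ ∧ 0 ≤ z 0 ∧ ‖z‖ ^ 2 - z 0 ^ 2 ≤ (2 / 3) ^ n * (‖x‖ ^ 2 - x 0 ^ 2) ∧ K z = K x := by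
  induction n with
  | zero =>
    obtain ⟨z, hz, hKz⟩ := exists_flip_coord hperm 0 x
    have hsq : ∀ i, z i ^ 2 = x i ^ 2 := by
      intro i; rw [hz]; split_ifs <;> simp
    refine ⟨z, norm_eq_of_sq_coord_eq hsq, ?_, ?_, hKz⟩
    · rw [hz, if_pos rfl]; exact abs_nonneg _
    · rw [norm_eq_of_sq_coord_eq hsq, hsq 0, pow_zero, one_mul]
  | succ n ih =>
    obtain ⟨z, hzn, hz0, hzt, hKz⟩ := ih
    obtain ⟨w, hw0, hw1, hw2, hw3, hKw⟩ := exists_flip_tail hperm z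
    have hwsq : ∀ i, w i ^ 2 = z i ^ 2 := by
      intro i; fin_cases i
      · show w 0 ^ 2 = z 0 ^ 2; rw [hw0]
      · show w 1 ^ 2 = z 1 ^ 2; rw [hw1, sq_abs]
      · show w 2 ^ 2 = z 2 ^ 2; rw [hw2, sq_abs]
      · show w 3 ^ 2 = z 3 ^ 2; rw [hw3, sq_abs]
    have hwn : ‖w‖ = ‖z‖ := norm_eq_of_sq_coord_eq hwsq
    have hwne : w ≠ 0 := by
      intro h0
      apply hx
      rw [← norm_eq_zero, ← hzn, ← hwn, h0, norm_zero]
    obtain ⟨v, hvn, hv0, hvt, hKv⟩ := exists_rotate_step hrot hwne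
      (by rw [hw1]; exact abs_nonneg _) (by rw [hw2]; exact abs_nonneg _) (by rw [hw3]; exact abs_nonneg _)
    refine ⟨v, by rw [hvn, hwn, hzn], hv0, ?_, by rw [hKv, hKw, hKz]⟩
    calc ‖v‖ ^ 2 - v 0 ^ 2 ≤ 2 / 3 * (‖w‖ ^ 2 - w 0 ^ 2) := hvt
      _ = 2 / 3 * (‖z‖ ^ 2 - z 0 ^ 2) := by rw [hwn, hw0]
      _ ≤ 2 / 3 * ((2 / 3) ^ n * (‖x‖ ^ 2 - x 0 ^ 2)) := by gcongr
      _ = (2 / 3) ^ (n + 1) * (‖x‖ ^ 2 - x 0 ^ 2) := by ring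

/-- Distance to the pole: for `‖z‖ = ρ` and `z₀ ≥ 0`, `‖z − ρ e₀‖² ≤ 2·(‖z‖² − z₀²)`. -/
theorem norm_sub_pole_sq_le (z : E4) (hz0 : 0 ≤ z 0) :
    ‖z - ‖z‖ • (EuclideanSpace.single 0 (1 : ℝ) : E4)‖ ^ 2 ≤ 2 * (‖z‖ ^ 2 - z 0 ^ 2) := by
  have hx2 : ‖z‖ ^ 2 = z 0 ^ 2 + z 1 ^ 2 + z 2 ^ 2 + z 3 ^ 2 :=
    by rw [EuclideanSpace.real_norm_sq_eq, Fin.sum_univ_four]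
  have hd : ‖z - ‖z‖ • (EuclideanSpace.single 0 (1 : ℝ) : E4)‖ ^ 2
      = (z 0 - ‖z‖) ^ 2 + z 1 ^ 2 + z 2 ^ 2 + z 3 ^ 2 := by
    rw [EuclideanSpace.real_norm_sq_eq, Fin.sum_univ_four]
    simp [Fin.ext_iff]
  rw [hd]
  have hle : z 0 ≤ ‖z‖ := by
    have : z 0 ^ 2 ≤ ‖z‖ ^ 2 := by rw [hx2]; nlinarith [sq_nonneg (z 1), sq_nonneg (z 2), sq_nonneg (z 3)]
    exact abs_le_of_sq_le_sq' this (norm_nonneg _) |>.2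
  nlinarith [norm_nonneg z]

/-! ## The theorem -/

/-- **`K` is radial off `0`**: `K x = K (‖x‖ e₀)` for `x ≠ 0`. -/
theorem apply_eq_apply_pole (hcont : ContinuousOn K {x | x ≠ 0})
    (hperm : ∀ R : E4 ≃ₗᵢ[ℝ] E4, IsSignedPerm R → ∀ x, K (R x) = K x)
    (hrot : ∀ (R : E2 ≃ₗᵢ[ℝ] E2) (y x : E2), y ≠ 0 → K (planeEmb (R y) + perpEmb x) = K (planeEmb y + perpEmb x))
    {x : E4} (hx : x ≠ 0) : K x = K (‖x‖ • (EuclideanSpace.single 0 (1 : ℝ) : E4)) := by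
  set p : E4 := ‖x‖ • (EuclideanSpace.single 0 (1 : ℝ) : E4) with hp
  have hxn : 0 < ‖x‖ := norm_pos_iff.2 hx
  have hpne : p ≠ 0 := by
    rw [hp]; exact smul_ne_zero hxn.ne' (by simp)
  have hKp : ContinuousAt K p := hcont.continuousAt (isOpen_ne.mem_nhds hpne)
  by_contra hne
  obtain ⟨ε, hε, hεK⟩ : ∃ ε : ℝ, 0 < ε ∧ ε ≤ dist (K x) (K p) := ⟨_, dist_pos.2 hne, le_rfl⟩
  obtain ⟨δ, hδ, hδK⟩ := Metric.continuousAt_iff.1 hKp ε hε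
  -- choose `n` with `2·(2/3)ⁿ·tail(x) < δ²`
  set t : ℝ := ‖x‖ ^ 2 - x 0 ^ 2 with ht
  have ht0 : 0 ≤ t := by
    rw [ht, EuclideanSpace.real_norm_sq_eq, Fin.sum_univ_four]; nlinarith [sq_nonneg (x 1), sq_nonneg (x 2), sq_nonneg (x 3)]
  obtain ⟨n, hn⟩ := exists_pow_lt_of_lt_one (show 0 < δ ^ 2 / (2 * t + 1) by positivity)
    (show (2 / 3 : ℝ) < 1 by norm_num)
  obtain ⟨z, hzn, hz0, hzt, hKz⟩ := exists_iterate hperm hrot hx n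
  have hdist : dist z p < δ := by
    rw [dist_eq_norm]
    have h1 := norm_sub_pole_sq_le z hz0
    rw [hzn] at h1
    have h2 : ‖z - p‖ ^ 2 < δ ^ 2 := by
      calc ‖z - p‖ ^ 2 ≤ 2 * (‖x‖ ^ 2 - z 0 ^ 2) := h1
        _ ≤ 2 * ((2 / 3) ^ n * t) := by rw [← hzn]; linarith
        _ ≤ (2 * t + 1) * (2 / 3) ^ n := by nlinarith [pow_nonneg (show (0:ℝ) ≤ 2 / 3 by norm_num) n]
        _ < (2 * t + 1) * (δ ^ 2 / (2 * t + 1)) := by gcongr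
        _ = δ ^ 2 := by field_simp
    exact (abs_lt_of_sq_lt_sq' h2 hδ.le).2
  have := hδK hdist
  rw [hKz] at this
  linarith

/-- ★ **H4 «CIRCLE TO SPHERE» (unfolded)**: a kernel continuous off `0`, `W(B₄)`-invariant and invariant under the isometries of the
hexagonal plane `Π₀` (acting as `R ⊕ id` in the registered frames `planeEmb`, `perpEmb`), is `O(4)`-invariant. -/
theorem circleToSphere_unfolded :
    ∀ K : E4 → ℝ, ContinuousOn K {x | x ≠ 0} →
      (∀ R : E4 ≃ₗᵢ[ℝ] E4, IsSignedPerm R → ∀ x, K (R x) = K x) →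
      (∀ (R : E2 ≃ₗᵢ[ℝ] E2) (y x : E2), y ≠ 0 → K (planeEmb (R y) + perpEmb x) = K (planeEmb y + perpEmb x)) →
      ∀ (R : E4 ≃ₗᵢ[ℝ] E4) (x : E4), K (R x) = K x := by
  intro K hcont hperm hrot R x
  by_cases hx : x = 0
  · subst hx; simp
  · have hRx : R x ≠ 0 := fun h => hx (by simpa using congrArg R.symm h)
    rw [apply_eq_apply_pole hcont hperm hrot hRx, apply_eq_apply_pole hcont hperm hrot hx, LinearIsometryEquiv.norm_map]

end Summit.QuantumFields.YangMills.Theorems.F4SubCurvatureDoorHermitianCircleToSphere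

end
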